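/-
Copyright (c) 2026. All rights reserved.
Released under Apache 2.0 license as described in the file LICENSE.
Authors: HodgeCM publication cell (pub/hodgecm-mathlib), Track B, seat K2E3-p25 (g0).
-/
import Summits.HodgeConjecture.HodgeConjecture.Theorems.K2E3GL3BruhatCellHaar             -- ★ E3β₂ (coordinates, measures, retractions)
import Literature.NumberTheory.Automorphic.ParabolicGLExactProofs                          -- ★ `IsSmooth.twist_comp_leviProjection`
import Literature.NumberTheory.Automorphic.IrreducibleClasses                              -- ★ `IsSmooth.twist`
import Literature.NumberTheory.Automorphic.SmoothIndClosedCellNonzero                      -- ★ `ParabolicTriple.rootDeltaChar_eq_one_of_mem_N`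
import Literature.NumberTheory.Automorphic.UnipotentRadicalCompactOpenProofs               -- ★ `IsLimitOfCompactOpen.of_le`, `isClosed_unipotentRadicalGL`
import Literature.NumberTheory.Automorphic.GLnLeviOrbitalDescent                           -- ★ `isClosed_standardLeviGL`
import Summits.HodgeConjecture.HodgeConjecture.Theorems.K2E3GL3BorelModulus                -- ★ `rootDeltaChar_borel_three`
import HarnessLib

/-!
# K2_E3 road (h413), leaf (nsc-S-A′), brick E3β₃ — each Bruhat cell of `GL₃` contributes exactly a line to `r_U(Ind_B^{GL₃} χδ^{1/2})`, with exponent `χ ∘ Ad(P_w)`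
Cell `pub/hodgecm-mathlib` (D-0151), Track B, seat K2E3-p25 (g0).  `--supports stmt-HodgeConjecture-24833 --as helper`; THEOREMS ONLY; COUNT-NEUTRAL.
For the inducing character `σ′ = (χ ∘ levi)·δ_B^{1/2}` of ★ `parabolicIndGL F id (𝟙.twist χ)` and a permutation `w ∈ S₃`, the hypotheses `hinv` (U-invariance of the Haar functional
`∫_{Γ_w} f(P_w γ)dγ` on `X^<_w`) and `hT` (torus equivariance with character `e_w = (χ ∘ levi ∘ Ad(P_w) ∘ diag)·(δ_B^{1/2} ∘ diag)` — the modulus of `γ ↦ diag⁻¹ γ diag` on `Γ_w` being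
EXACTLY `δ_B^{1/2}(diag)/δ_B^{1/2}(P_w diag P_w⁻¹)`, ★ `rootDeltaChar_borel_three`) of ★ E3γ2 are discharged from ★ E3β₁∕E3β₂; output per cell: a functional `Λ_w` on `J` with
`ker Λ_w ∩ F^<_w = F^≤_w`, `Λ_w ≠ 0` on `F^<_w`, and `Λ_w(r(m)x) = χ(levi(P_w diag(m) P_w⁻¹))·Λ_w(x)` — the exponent of cell `w` is `χ ∘ Ad(P_w)`, with NO modulus factor left.
HONEST LABEL: HC_CM is proved only modulo the 7 printed citations (2 remaining named inputs: hLiu418 = stmt-HodgeConjecture-24832, h413 = stmt-HodgeConjecture-24833) until rung 0 closes.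
## References
* [BernsteinZelevinsky1977] I. N. Bernstein, A. V. Zelevinsky, *Induced representations of reductive p-adic groups I*, Ann. Sci. ÉNS 10 (1977), 1.7–1.9, §2.3, Thm. 5.2.
* [Casselman1995] W. Casselman, *Introduction to the theory of admissible representations of p-adic reductive groups* (draft 1995), §1.5, §6.3 (Thm. 6.3.5).
-/

set_option autoImplicit false
set_option linter.dupNamespace false

noncomputable section

open Set Function MeasureTheory Measure Filter Representation
open scoped MatrixGroups NNReal ENNReal

namespace Summit.HodgeConjecture.HodgeConjecture.Cruxes.H413.K2E3GL3BruhatCellFunctionals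

open Literature.NumberTheory.Automorphic ValuativeRel
open Literature.NumberTheory.GaloisRepresentations Literature.NumberTheory.GaloisRepresentations.IsNonarchimedeanLocalField
open Summit.HodgeConjecture.HodgeConjecture.Cruxes.H413.K2E3GL3BorelUnipotentHaar
open Summit.HodgeConjecture.HodgeConjecture.Cruxes.H413.K2E3GL3BruhatCellSubgroups
open Summit.HodgeConjecture.HodgeConjecture.Cruxes.H413.K2E3GL3BruhatCellHaar
open Summit.HodgeConjecture.HodgeConjecture.Cruxes.H413.K2E3BorelCellJacquetLine
open Summit.HodgeConjecture.HodgeConjecture.Cruxes.H413.K2E3BorelCellCoinvariantsBound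

variable {F : Type} [Field F] [ValuativeRel F] [TopologicalSpace F] [IsNonarchimedeanLocalField F]

/-! ## §1 The inducing character `σ′ = (χ ∘ levi)·δ_B^{1/2}` -/

/-- `σ′(b) z = δ^{1/2}(b)·χ(levi b)·z`. [cite: BernsteinZelevinsky1977, §2.3] -/
theorem inducingChar_apply (χ : (Π a : Fin 3, GL {i : Fin 3 // (id : Fin 3 → Fin 3) i = a} F) →* ℂˣ)
    (b : ↥(standardParabolicGL F (id : Fin 3 → Fin 3))) (z : ℂ) :
    Representation.twist (((Representation.trivial ℂ (Π a : Fin 3, GL {i : Fin 3 // (id : Fin 3 → Fin 3) i = a} F) ℂ).twist χ).comp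
        (leviProjection F (id : Fin 3 → Fin 3))) (rootDeltaChar (standardParabolicGL F (id : Fin 3 → Fin 3))) b z =
      ((rootDeltaChar (standardParabolicGL F (id : Fin 3 → Fin 3)) b : ℂˣ) : ℂ) * (((χ (leviProjection F (id : Fin 3 → Fin 3) b) : ℂˣ) : ℂ) * z) := by
  simp only [Representation.twist_apply, MonoidHom.coe_comp, Function.comp_apply, Representation.trivial_apply, smul_eq_mul]

/-- `σ′(u) = 1` for `u ∈ U` (`levi u = 1`, `δ^{1/2}|_U = 1`, ★ `ParabolicTriple.rootDeltaChar_eq_one_of_mem_N`). [cite: BernsteinZelevinsky1977, 1.7 and §1.9] -/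
theorem inducingChar_apply_of_mem_upperUnitriangular (χ : (Π a : Fin 3, GL {i : Fin 3 // (id : Fin 3 → Fin 3) i = a} F) →* ℂˣ)
    {u : GL (Fin 3) F} (hu : u ∈ upperUnitriangular (Fin 3) F) (z : ℂ) :
    Representation.twist (((Representation.trivial ℂ (Π a : Fin 3, GL {i : Fin 3 // (id : Fin 3 → Fin 3) i = a} F) ℂ).twist χ).comp
        (leviProjection F (id : Fin 3 → Fin 3))) (rootDeltaChar (standardParabolicGL F (id : Fin 3 → Fin 3)))
        ⟨u, unipotentRadicalGL_le F (id : Fin 3 → Fin 3) hu⟩ z = z := by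
  rw [inducingChar_apply]
  have h1 : leviProjection F (id : Fin 3 → Fin 3) ⟨u, unipotentRadicalGL_le F (id : Fin 3 → Fin 3) hu⟩ = 1 := by
    obtain ⟨p, hp, rfl⟩ := hu
    exact (MonoidHom.mem_ker).1 hp
  haveI : LocallyCompactSpace ↥(parabolicTripleGL F (id : Fin 3 → Fin 3)).P :=
    inferInstanceAs (LocallyCompactSpace ↥(standardParabolicGL F (id : Fin 3 → Fin 3)))
  have h2 : rootDeltaChar (standardParabolicGL F (id : Fin 3 → Fin 3)) ⟨u, unipotentRadicalGL_le F (id : Fin 3 → Fin 3) hu⟩ = 1 :=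
    ParabolicTriple.rootDeltaChar_eq_one_of_mem_N (t := parabolicTripleGL F (id : Fin 3 → Fin 3))
      (isLimitOfCompactOpen_parabolicTripleGL_N F (id : Fin 3 → Fin 3) monotone_id) hu
  rw [h1, h2, map_one, Units.val_one, one_mul, one_mul]

/-- `σ′` is smooth when `ker χ` is open. [cite: BernsteinZelevinsky1977, §1.8] -/
theorem isSmooth_inducingChar (χ : (Π a : Fin 3, GL {i : Fin 3 // (id : Fin 3 → Fin 3) i = a} F) →* ℂˣ)
    (hχ : IsOpen (χ.ker : Set (Π a : Fin 3, GL {i : Fin 3 // (id : Fin 3 → Fin 3) i = a} F))) :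
    (Representation.twist (((Representation.trivial ℂ (Π a : Fin 3, GL {i : Fin 3 // (id : Fin 3 → Fin 3) i = a} F) ℂ).twist χ).comp
        (leviProjection F (id : Fin 3 → Fin 3))) (rootDeltaChar (standardParabolicGL F (id : Fin 3 → Fin 3)))).IsSmooth := by
  refine IsSmooth.twist_comp_leviProjection F (id : Fin 3 → Fin 3) (IsSmooth.twist (fun v => ?_) hχ)
  have htop : (Representation.trivial ℂ (Π a : Fin 3, GL {i : Fin 3 // (id : Fin 3 → Fin 3) i = a} F) ℂ).stabilizerSubgroup v = ⊤ :=
    (Subgroup.eq_top_iff' _).2 fun g => (Representation.mem_stabilizerSubgroup _ v g).2 rfl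
  rw [isSmoothVector_iff, htop, Subgroup.coe_top]
  exact isOpen_univ

omit [ValuativeRel F] [TopologicalSpace F] [IsNonarchimedeanLocalField F] in
/-- `γ s γ⁻¹ ∈ U_c` for `γ ∈ P_c`, `s ∈ U_c` (`U_c ⊴ P_c`). [cite: BernsteinZelevinsky1977, §2.1] -/
theorem conj_mem_unipotentRadicalGL_of_mem_parabolic {α : Type*} [LinearOrder α] (c : Fin 3 → α) {m u : GL (Fin 3) F}
    (hm : m ∈ standardParabolicGL F c) (hu : u ∈ unipotentRadicalGL F c) : m * u * m⁻¹ ∈ unipotentRadicalGL F c := by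
  have huP : u ∈ standardParabolicGL F c := unipotentRadicalGL_le F c hu
  have hu' : (⟨u, huP⟩ : standardParabolicGL F c) ∈ unipotentRadicalP F c := by
    rw [← unipotentRadicalGL_subgroupOf]; exact hu
  have h := (inferInstance : (unipotentRadicalP F c).Normal).conj_mem _ hu' ⟨m, hm⟩
  rw [← unipotentRadicalGL_subgroupOf, Subgroup.mem_subgroupOf] at h
  exact h

omit [ValuativeRel F] [TopologicalSpace F] [IsNonarchimedeanLocalField F] in
/-- `U ≤ Q = P_{![f,f,t]}` and `U ≤ Q′ = P_{![f,t,t]}`. [cite: BernsteinZelevinsky1977, §2.1] -/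
theorem upperUnitriangular_le_parabolic_two_block :
    upperUnitriangular (Fin 3) F ≤ standardParabolicGL F (![false, false, true] : Fin 3 → Bool) ∧
    upperUnitriangular (Fin 3) F ≤ standardParabolicGL F (![false, true, true] : Fin 3 → Bool) := by
  refine ⟨fun g hg => ?_, fun g hg => ?_⟩ <;>
  · obtain ⟨h10, h20, h21, -, -, -⟩ := (mem_upperUnitriangular_three_iff g).1 hg
    rw [mem_standardParabolicGL_iff]
    intro i j hij
    fin_cases i <;> fin_cases j <;> simp_all (config := {decide := true})


/-! ## §2 Cell `s₁ = (0 1)`: `Γ = U_{α₁} ≅ F`, `S = U_Q` (normal in `Q ⊇ U`) -/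

set_option maxHeartbeats 400000 in
/-- **Cell `s₁` contributes exactly a line to `r_U(Ind_B χδ^{1/2})`, with exponent `χ ∘ Ad(P_{s₁})`** (★ E3γ2 with the cell datum of ★ E3β₁, the Haar measure of ★ E3β₂
transported from `μ_F`; `hinv` by normality of `U_Q` in `U` and right invariance; `hT` by the substitution `x ↦ (d₁/d₀)x` of module `‖d₀/d₁‖ = δ^{1/2}(diag)/δ^{1/2}(P diag P⁻¹)`).
[cite: BernsteinZelevinsky1977, Thm. 5.2] [cite: Casselman1995, §6.3, Thm. 6.3.5] -/
theorem exists_lineFunctional_cell_swap_zero_one (χ : (Π a : Fin 3, GL {i : Fin 3 // (id : Fin 3 → Fin 3) i = a} F) →* ℂˣ) (hχ : IsOpen (χ.ker : Set (Π a : Fin 3, GL {i : Fin 3 // (id : Fin 3 → Fin 3) i = a} F))) :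
    let σ' := Representation.twist (((Representation.trivial ℂ (Π a : Fin 3, GL {i : Fin 3 // (id : Fin 3 → Fin 3) i = a} F) ℂ).twist χ).comp (leviProjection F (id : Fin 3 → Fin 3))) (rootDeltaChar (standardParabolicGL F (id : Fin 3 → Fin 3)))
    let I := smoothIndRep (standardParabolicGL F (id : Fin 3 → Fin 3)) σ'
    let mk := Coinvariants.mk (restrictUnipotentGL F (id : Fin 3 → Fin 3) I)
    let Flt := (vanishingOn (standardParabolicGL F (id : Fin 3 → Fin 3)) σ' (cellLT (K := F) (id : Fin 3 → Fin 3) (Equiv.swap (0 : Fin 3) 1))).map mk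
    let Fle := (vanishingOn (standardParabolicGL F (id : Fin 3 → Fin 3)) σ' (cellLE (K := F) (id : Fin 3 → Fin 3) (Equiv.swap (0 : Fin 3) 1))).map mk
    ∃ Λ : (restrictUnipotentGL F (id : Fin 3 → Fin 3) I).Coinvariants →ₗ[ℂ] ℂ,
      (∀ x ∈ Flt, Λ x = 0 ↔ x ∈ Fle) ∧ (∃ x ∈ Flt, Λ x ≠ 0) ∧
      ∀ (m : (Π a : Fin 3, GL {i : Fin 3 // (id : Fin 3 → Fin 3) i = a} F)), ∀ x ∈ Flt,
        Λ (Representation.normalizedJacquetGL F (id : Fin 3 → Fin 3) I m x) =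
          ((χ (leviProjection F (id : Fin 3 → Fin 3) ⟨(permGL (Equiv.swap (0 : Fin 3) 1) : GL (Fin 3) F) * blockDiagonalGL F (id : Fin 3 → Fin 3) m * (permGL (Equiv.swap (0 : Fin 3) 1) : GL (Fin 3) F)⁻¹, permGL_conj_blockDiagonalGL_mem_borel (Equiv.swap (0 : Fin 3) 1) m⟩) : ℂˣ) : ℂ) * Λ x := by
  intro σ' I mk Flt Fle
  haveI : T2Space F := (isLocalField F).toT2Space
  haveI : LocallyCompactSpace F := (isLocalField F).toLocallyCompactSpace
  haveI : SecondCountableTopology F := secondCountableTopology_localField F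
  letI : MeasurableSpace F := borel F
  haveI : BorelSpace F := ⟨rfl⟩
  -- the cell datum (★ E3β₁) and the retraction (★ E3β₂)
  obtain ⟨hΓlow, hS, hSB, hdec⟩ := cellDatum_swap_zero_one (F := F)
  have hΓU : (unipotentRadicalGL F (![false, true, true] : Fin 3 → Bool) ⊓ standardLeviGL F (![false, false, true] : Fin 3 → Bool)) ≤ upperUnitriangular (Fin 3) F := (rootSubgroups_le (F := F)).2.2.1
  have hQU : unipotentRadicalGL F (![false, false, true] : Fin 3 → Bool) ≤ upperUnitriangular (Fin 3) F := (rootSubgroups_le (F := F)).1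
  have hΓcl : IsClosed (((unipotentRadicalGL F (![false, true, true] : Fin 3 → Bool) ⊓ standardLeviGL F (![false, false, true] : Fin 3 → Bool)) : Subgroup (GL (Fin 3) F)) : Set (GL (Fin 3) F)) := by
    rw [Subgroup.coe_inf]; exact (isClosed_unipotentRadicalGL _).inter (isClosed_standardLeviGL _)
  have hΓlim : IsLimitOfCompactOpen ↥(unipotentRadicalGL F (![false, true, true] : Fin 3 → Bool) ⊓ standardLeviGL F (![false, false, true] : Fin 3 → Bool)) := (isLimitOfCompactOpen_upperUnitriangular F 3).of_le hΓU hΓcl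
  obtain ⟨proj, hproj, hprojS⟩ := exists_proj_swap_zero_one (F := F)
  -- coordinates (★ p11) and the transported Haar measure on `Γ` (★ E3β₂)
  obtain ⟨e, he⟩ := exists_coordHomeomorph (R := F)
  obtain ⟨φ, hφ, hφadd⟩ := exists_homeomorph_rootGroup_zeroOne e he
  letI : MeasurableSpace ↥(unipotentRadicalGL F (![false, true, true] : Fin 3 → Bool) ⊓ standardLeviGL F (![false, false, true] : Fin 3 → Bool)) := borel _
  haveI : BorelSpace ↥(unipotentRadicalGL F (![false, true, true] : Fin 3 → Bool) ⊓ standardLeviGL F (![false, false, true] : Fin 3 → Bool)) := ⟨rfl⟩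
  obtain ⟨i1, i2, i3⟩ := measure_map_addHomeomorph φ hφadd (Measure.addHaar : Measure F)
  haveI := i1; haveI := i2; haveI := i3
  have hme : MeasurableEmbedding φ := φ.measurableEmbedding
  -- the torus character `e_w = (χ ∘ levi ∘ Ad P_w ∘ diag) · (δ^{1/2} ∘ diag)`
  let conjB : (Π a : Fin 3, GL {i : Fin 3 // (id : Fin 3 → Fin 3) i = a} F) →* ↥(standardParabolicGL F (id : Fin 3 → Fin 3)) :=
    ((MulAut.conj (permGL (Equiv.swap (0 : Fin 3) 1) : GL (Fin 3) F)).toMonoidHom.comp (blockDiagonalGL F (id : Fin 3 → Fin 3))).codRestrict (standardParabolicGL F (id : Fin 3 → Fin 3))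
      (fun m => permGL_conj_blockDiagonalGL_mem_borel (Equiv.swap (0 : Fin 3) 1) m)
  have hconjB : ∀ m : (Π a : Fin 3, GL {i : Fin 3 // (id : Fin 3 → Fin 3) i = a} F), ((conjB m : ↥(standardParabolicGL F (id : Fin 3 → Fin 3))) : GL (Fin 3) F) = (permGL (Equiv.swap (0 : Fin 3) 1) : GL (Fin 3) F) * blockDiagonalGL F (id : Fin 3 → Fin 3) m * (permGL (Equiv.swap (0 : Fin 3) 1) : GL (Fin 3) F)⁻¹ := fun m => rfl
  let ew : (Π a : Fin 3, GL {i : Fin 3 // (id : Fin 3 → Fin 3) i = a} F) →* ℂˣ := (χ.comp ((leviProjection F (id : Fin 3 → Fin 3)).comp conjB)) *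
    (rootDeltaChar (standardParabolicGL F (id : Fin 3 → Fin 3))).comp (leviEmbeddingP F (id : Fin 3 → Fin 3))
  obtain ⟨Λ, hker, hne, hequiv⟩ := exists_lineFunctional_of_cellDatum σ' (Equiv.swap (0 : Fin 3) 1) (unipotentRadicalGL F (![false, true, true] : Fin 3 → Bool) ⊓ standardLeviGL F (![false, false, true] : Fin 3 → Bool)) (unipotentRadicalGL F (![false, false, true] : Fin 3 → Bool)) (isSmooth_inducingChar χ hχ)
    hΓU hΓcl hΓlim hΓlow hS hSB hdec proj hproj hprojS ((Measure.addHaar : Measure F).map φ)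
    (by
      intro u hu f hf
      obtain ⟨s₀, hs₀, γ₀, hγ₀, rfl⟩ := hdec u hu
      have hfun : (fun γ : ↥(unipotentRadicalGL F (![false, true, true] : Fin 3 → Bool) ⊓ standardLeviGL F (![false, false, true] : Fin 3 → Bool)) => (smoothIndRep (standardParabolicGL F (id : Fin 3 → Fin 3)) σ' (s₀ * γ₀) f).toFun ((permGL (Equiv.swap (0 : Fin 3) 1) : GL (Fin 3) F) * ((γ : ↥(unipotentRadicalGL F (![false, true, true] : Fin 3 → Bool) ⊓ standardLeviGL F (![false, false, true] : Fin 3 → Bool))) : GL (Fin 3) F))) =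
          fun γ => f.toFun ((permGL (Equiv.swap (0 : Fin 3) 1) : GL (Fin 3) F) * (((γ * ⟨γ₀, hγ₀⟩ : ↥(unipotentRadicalGL F (![false, true, true] : Fin 3 → Bool) ⊓ standardLeviGL F (![false, false, true] : Fin 3 → Bool)))) : GL (Fin 3) F)) := by
        funext γ
        have hγU : ((γ : ↥(unipotentRadicalGL F (![false, true, true] : Fin 3 → Bool) ⊓ standardLeviGL F (![false, false, true] : Fin 3 → Bool))) : GL (Fin 3) F) ∈ upperUnitriangular (Fin 3) F := hΓU γ.2
        have hγQ : ((γ : ↥(unipotentRadicalGL F (![false, true, true] : Fin 3 → Bool) ⊓ standardLeviGL F (![false, false, true] : Fin 3 → Bool))) : GL (Fin 3) F) ∈ standardParabolicGL F (![false, false, true] : Fin 3 → Bool) :=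
          (upperUnitriangular_le_parabolic_two_block (F := F)).1 hγU
        have hmemS : ((γ : ↥(unipotentRadicalGL F (![false, true, true] : Fin 3 → Bool) ⊓ standardLeviGL F (![false, false, true] : Fin 3 → Bool))) : GL (Fin 3) F) * s₀ * ((γ : ↥(unipotentRadicalGL F (![false, true, true] : Fin 3 → Bool) ⊓ standardLeviGL F (![false, false, true] : Fin 3 → Bool))) : GL (Fin 3) F)⁻¹ ∈ unipotentRadicalGL F (![false, false, true] : Fin 3 → Bool) := conj_mem_unipotentRadicalGL_of_mem_parabolic _ hγQ hs₀
        have hB' := hSB _ hmemS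
        have hU' : (permGL (Equiv.swap (0 : Fin 3) 1) : GL (Fin 3) F) * (((γ : ↥(unipotentRadicalGL F (![false, true, true] : Fin 3 → Bool) ⊓ standardLeviGL F (![false, false, true] : Fin 3 → Bool))) : GL (Fin 3) F) * s₀ * ((γ : ↥(unipotentRadicalGL F (![false, true, true] : Fin 3 → Bool) ⊓ standardLeviGL F (![false, false, true] : Fin 3 → Bool))) : GL (Fin 3) F)⁻¹) * (permGL (Equiv.swap (0 : Fin 3) 1) : GL (Fin 3) F)⁻¹ ∈ upperUnitriangular (Fin 3) F := permGL_conj_mem_upperUnitriangular _ (hQU hmemS) hB'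
        rw [toFun_smoothIndRep_apply]
        have hprod : (permGL (Equiv.swap (0 : Fin 3) 1) : GL (Fin 3) F) * ((γ : ↥(unipotentRadicalGL F (![false, true, true] : Fin 3 → Bool) ⊓ standardLeviGL F (![false, false, true] : Fin 3 → Bool))) : GL (Fin 3) F) * (s₀ * γ₀) =
            ((permGL (Equiv.swap (0 : Fin 3) 1) : GL (Fin 3) F) * (((γ : ↥(unipotentRadicalGL F (![false, true, true] : Fin 3 → Bool) ⊓ standardLeviGL F (![false, false, true] : Fin 3 → Bool))) : GL (Fin 3) F) * s₀ * ((γ : ↥(unipotentRadicalGL F (![false, true, true] : Fin 3 → Bool) ⊓ standardLeviGL F (![false, false, true] : Fin 3 → Bool))) : GL (Fin 3) F)⁻¹) * (permGL (Equiv.swap (0 : Fin 3) 1) : GL (Fin 3) F)⁻¹) * ((permGL (Equiv.swap (0 : Fin 3) 1) : GL (Fin 3) F) * (((γ : ↥(unipotentRadicalGL F (![false, true, true] : Fin 3 → Bool) ⊓ standardLeviGL F (![false, false, true] : Fin 3 → Bool))) : GL (Fin 3) F) * γ₀)) := by group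
        rw [hprod, show (permGL (Equiv.swap (0 : Fin 3) 1) : GL (Fin 3) F) * (((γ : ↥(unipotentRadicalGL F (![false, true, true] : Fin 3 → Bool) ⊓ standardLeviGL F (![false, false, true] : Fin 3 → Bool))) : GL (Fin 3) F) * s₀ * ((γ : ↥(unipotentRadicalGL F (![false, true, true] : Fin 3 → Bool) ⊓ standardLeviGL F (![false, false, true] : Fin 3 → Bool))) : GL (Fin 3) F)⁻¹) * (permGL (Equiv.swap (0 : Fin 3) 1) : GL (Fin 3) F)⁻¹ =
            ((⟨_, unipotentRadicalGL_le F (id : Fin 3 → Fin 3) hU'⟩ : ↥(standardParabolicGL F (id : Fin 3 → Fin 3))) : GL (Fin 3) F) from rfl, SmoothInd.toFun_subgroup_mul,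
          inducingChar_apply_of_mem_upperUnitriangular χ hU']
        rfl
      rw [hfun]
      exact integral_mul_right_eq_self (fun γ : ↥(unipotentRadicalGL F (![false, true, true] : Fin 3 → Bool) ⊓ standardLeviGL F (![false, false, true] : Fin 3 → Bool)) => f.toFun ((permGL (Equiv.swap (0 : Fin 3) 1) : GL (Fin 3) F) * ((γ : ↥(unipotentRadicalGL F (![false, true, true] : Fin 3 → Bool) ⊓ standardLeviGL F (![false, false, true] : Fin 3 → Bool))) : GL (Fin 3) F))) ⟨γ₀, hγ₀⟩
      ) ew (by
      intro m f hf
      have hd0 := blockDiagonalGL_id_three_apply_ne_zero m 0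
      have hd1 := blockDiagonalGL_id_three_apply_ne_zero m 1
      have hd2 := blockDiagonalGL_id_three_apply_ne_zero m 2
      have hmemB : (permGL (Equiv.swap (0 : Fin 3) 1) : GL (Fin 3) F) * blockDiagonalGL F (id : Fin 3 → Fin 3) m * (permGL (Equiv.swap (0 : Fin 3) 1) : GL (Fin 3) F)⁻¹ ∈ standardParabolicGL F (id : Fin 3 → Fin 3) := permGL_conj_blockDiagonalGL_mem_borel (Equiv.swap (0 : Fin 3) 1) m
      -- the integrand: `f(P γ t) = σ′(P t P⁻¹) · f(P (t⁻¹ γ t))`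
      have hfun : (fun γ : ↥(unipotentRadicalGL F (![false, true, true] : Fin 3 → Bool) ⊓ standardLeviGL F (![false, false, true] : Fin 3 → Bool)) => (smoothIndRep (standardParabolicGL F (id : Fin 3 → Fin 3)) σ' (blockDiagonalGL F (id : Fin 3 → Fin 3) m) f).toFun ((permGL (Equiv.swap (0 : Fin 3) 1) : GL (Fin 3) F) * ((γ : ↥(unipotentRadicalGL F (![false, true, true] : Fin 3 → Bool) ⊓ standardLeviGL F (![false, false, true] : Fin 3 → Bool))) : GL (Fin 3) F))) =
          fun γ => (((rootDeltaChar (standardParabolicGL F (id : Fin 3 → Fin 3)) ⟨_, hmemB⟩ : ℂˣ) : ℂ) * (((χ (leviProjection F (id : Fin 3 → Fin 3) ⟨_, hmemB⟩)) : ℂˣ) : ℂ)) *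
            f.toFun ((permGL (Equiv.swap (0 : Fin 3) 1) : GL (Fin 3) F) * ((blockDiagonalGL F (id : Fin 3 → Fin 3) m)⁻¹ * ((γ : ↥(unipotentRadicalGL F (![false, true, true] : Fin 3 → Bool) ⊓ standardLeviGL F (![false, false, true] : Fin 3 → Bool))) : GL (Fin 3) F) * blockDiagonalGL F (id : Fin 3 → Fin 3) m)) := by
        funext γ
        rw [toFun_smoothIndRep_apply]
        have hprod : (permGL (Equiv.swap (0 : Fin 3) 1) : GL (Fin 3) F) * ((γ : ↥(unipotentRadicalGL F (![false, true, true] : Fin 3 → Bool) ⊓ standardLeviGL F (![false, false, true] : Fin 3 → Bool))) : GL (Fin 3) F) * blockDiagonalGL F (id : Fin 3 → Fin 3) m = ((permGL (Equiv.swap (0 : Fin 3) 1) : GL (Fin 3) F) * blockDiagonalGL F (id : Fin 3 → Fin 3) m * (permGL (Equiv.swap (0 : Fin 3) 1) : GL (Fin 3) F)⁻¹) * ((permGL (Equiv.swap (0 : Fin 3) 1) : GL (Fin 3) F) * ((blockDiagonalGL F (id : Fin 3 → Fin 3) m)⁻¹ * ((γ : ↥(unipotentRadicalGL F (![false, true,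 true] : Fin 3 → Bool) ⊓ standardLeviGL F (![false, false, true] : Fin 3 → Bool))) : GL (Fin 3) F) * blockDiagonalGL F (id : Fin 3 → Fin 3) m)) := by group
        rw [hprod]
        refine (SmoothInd.toFun_subgroup_mul f ⟨_, hmemB⟩ _).trans ?_
        rw [inducingChar_apply]
        exact (mul_assoc _ _ _).symm
      rw [hfun, integral_const_mul]
      -- the substitution `γ ↦ t⁻¹ γ t` on `Γ ≅ F`: `x ↦ α x`, `α = d₁/d₀`, module `‖α⁻¹‖`
      have hα : (((blockDiagonalGL F (id : Fin 3 → Fin 3) m : GL (Fin 3) F) : Matrix (Fin 3) (Fin 3) F) 1 1 / ((blockDiagonalGL F (id : Fin 3 → Fin 3) m : GL (Fin 3) F) : Matrix (Fin 3) (Fin 3) F) 0 0) ≠ 0 := div_ne_zero hd1 hd0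
      have hconj : ∀ x : F, (blockDiagonalGL F (id : Fin 3 → Fin 3) m)⁻¹ * ((φ x : ↥(unipotentRadicalGL F (![false, true, true] : Fin 3 → Bool) ⊓ standardLeviGL F (![false, false, true] : Fin 3 → Bool))) : GL (Fin 3) F) * blockDiagonalGL F (id : Fin 3 → Fin 3) m =
          ((φ ((((blockDiagonalGL F (id : Fin 3 → Fin 3) m : GL (Fin 3) F) : Matrix (Fin 3) (Fin 3) F) 1 1 / ((blockDiagonalGL F (id : Fin 3 → Fin 3) m : GL (Fin 3) F) : Matrix (Fin 3) (Fin 3) F) 0 0) * x) : ↥(unipotentRadicalGL F (![false, true, true] : Fin 3 → Bool) ⊓ standardLeviGL F (![false, false, true] : Fin 3 → Bool))) : GL (Fin 3) F) := by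
        intro x
        rw [hφ, hφ, blockDiagonalGL_inv_mul_coord_mul e he m ((x, 0), 0)]
        congr 2
        ext <;> simp; ring
      have hsub : ∫ γ, f.toFun ((permGL (Equiv.swap (0 : Fin 3) 1) : GL (Fin 3) F) * ((blockDiagonalGL F (id : Fin 3 → Fin 3) m)⁻¹ * ((γ : ↥(unipotentRadicalGL F (![false, true, true] : Fin 3 → Bool) ⊓ standardLeviGL F (![false, false, true] : Fin 3 → Bool))) : GL (Fin 3) F) * blockDiagonalGL F (id : Fin 3 → Fin 3) m)) ∂((Measure.addHaar : Measure F).map φ) =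
          ((normAbs F (((blockDiagonalGL F (id : Fin 3 → Fin 3) m : GL (Fin 3) F) : Matrix (Fin 3) (Fin 3) F) 1 1 / ((blockDiagonalGL F (id : Fin 3 → Fin 3) m : GL (Fin 3) F) : Matrix (Fin 3) (Fin 3) F) 0 0)⁻¹ : ℝ≥0) : ℝ) *
            ∫ γ, f.toFun ((permGL (Equiv.swap (0 : Fin 3) 1) : GL (Fin 3) F) * ((γ : ↥(unipotentRadicalGL F (![false, true, true] : Fin 3 → Bool) ⊓ standardLeviGL F (![false, false, true] : Fin 3 → Bool))) : GL (Fin 3) F)) ∂((Measure.addHaar : Measure F).map φ) := by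
        rw [hme.integral_map, hme.integral_map]
        simp_rw [hconj]
        have hmap := map_mul_left_addHaar (Measure.addHaar : Measure F) hα
        have heq := integral_map_equiv ((Homeomorph.mulLeft₀ _ hα).toMeasurableEquiv)
          (fun x : F => f.toFun ((permGL (Equiv.swap (0 : Fin 3) 1) : GL (Fin 3) F) * ((φ x : ↥(unipotentRadicalGL F (![false, true, true] : Fin 3 → Bool) ⊓ standardLeviGL F (![false, false, true] : Fin 3 → Bool))) : GL (Fin 3) F))) (μ := (Measure.addHaar : Measure F))
        rw [Homeomorph.toMeasurableEquiv_coe] at heq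
        change ∫ y, f.toFun ((permGL (Equiv.swap (0 : Fin 3) 1) : GL (Fin 3) F) * ((φ y : ↥(unipotentRadicalGL F (![false, true, true] : Fin 3 → Bool) ⊓ standardLeviGL F (![false, false, true] : Fin 3 → Bool))) : GL (Fin 3) F)) ∂((Measure.addHaar : Measure F).map (fun x => ((blockDiagonalGL F (id : Fin 3 → Fin 3) m : GL (Fin 3) F) : Matrix (Fin 3) (Fin 3) F) 1 1 / ((blockDiagonalGL F (id : Fin 3 → Fin 3) m : GL (Fin 3) F) : Matrix (Fin 3) (Fin 3) F) 0 0 * x)) =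
          ∫ x, f.toFun ((permGL (Equiv.swap (0 : Fin 3) 1) : GL (Fin 3) F) * ((φ (((blockDiagonalGL F (id : Fin 3 → Fin 3) m : GL (Fin 3) F) : Matrix (Fin 3) (Fin 3) F) 1 1 / ((blockDiagonalGL F (id : Fin 3 → Fin 3) m : GL (Fin 3) F) : Matrix (Fin 3) (Fin 3) F) 0 0 * x) : ↥(unipotentRadicalGL F (![false, true, true] : Fin 3 → Bool) ⊓ standardLeviGL F (![false, false, true] : Fin 3 → Bool))) : GL (Fin 3) F)) ∂(Measure.addHaar : Measure F) at heq
        rw [← heq, hmap, integral_smul_measure, ENNReal.coe_toReal, Complex.real_smul]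
      rw [hsub]
      -- the constant: `δ^{1/2}(P t P⁻¹) χ(…) ‖α⁻¹‖ = χ(…) δ^{1/2}(t) = e_w(m)`
      have hw0 : Equiv.swap (0 : Fin 3) 1 0 = 1 := by decide
      have hw2 : Equiv.swap (0 : Fin 3) 1 2 = 2 := by decide
      have hew : ((ew m : ℂˣ) : ℂ) = (((χ (leviProjection F (id : Fin 3 → Fin 3) ⟨_, hmemB⟩)) : ℂˣ) : ℂ) *
          ((rootDeltaChar (standardParabolicGL F (id : Fin 3 → Fin 3)) (leviEmbeddingP F (id : Fin 3 → Fin 3) m) : ℂˣ) : ℂ) := by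
        simp only [ew, MonoidHom.mul_apply, MonoidHom.coe_comp, Function.comp_apply, Units.val_mul]
        rfl
      have hδ1 : ((rootDeltaChar (standardParabolicGL F (id : Fin 3 → Fin 3)) ⟨_, hmemB⟩ : ℂˣ) : ℂ) =
          (((normAbs F (((blockDiagonalGL F (id : Fin 3 → Fin 3) m : GL (Fin 3) F) : Matrix (Fin 3) (Fin 3) F) 1 1) * (normAbs F (((blockDiagonalGL F (id : Fin 3 → Fin 3) m : GL (Fin 3) F) : Matrix (Fin 3) (Fin 3) F) 2 2))⁻¹ : ℝ≥0) : ℝ) : ℂ) := by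
        rw [K2E3GL3BorelModulus.rootDeltaChar_borel_three]
        simp only [permGL_conj_apply, hw0, hw2]
      have hδ2 : ((rootDeltaChar (standardParabolicGL F (id : Fin 3 → Fin 3)) (leviEmbeddingP F (id : Fin 3 → Fin 3) m) : ℂˣ) : ℂ) =
          (((normAbs F (((blockDiagonalGL F (id : Fin 3 → Fin 3) m : GL (Fin 3) F) : Matrix (Fin 3) (Fin 3) F) 0 0) * (normAbs F (((blockDiagonalGL F (id : Fin 3 → Fin 3) m : GL (Fin 3) F) : Matrix (Fin 3) (Fin 3) F) 2 2))⁻¹ : ℝ≥0) : ℝ) : ℂ) := by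
        rw [K2E3GL3BorelModulus.rootDeltaChar_borel_three, coe_leviEmbeddingP]
      have hn1 : normAbs F (((blockDiagonalGL F (id : Fin 3 → Fin 3) m : GL (Fin 3) F) : Matrix (Fin 3) (Fin 3) F) 1 1) ≠ 0 := (map_ne_zero _).2 hd1
      have hn0 : normAbs F (((blockDiagonalGL F (id : Fin 3 → Fin 3) m : GL (Fin 3) F) : Matrix (Fin 3) (Fin 3) F) 0 0) ≠ 0 := (map_ne_zero _).2 hd0
      have key : (normAbs F (((blockDiagonalGL F (id : Fin 3 → Fin 3) m : GL (Fin 3) F) : Matrix (Fin 3) (Fin 3) F) 1 1) * (normAbs F (((blockDiagonalGL F (id : Fin 3 → Fin 3) m : GL (Fin 3) F) : Matrix (Fin 3) (Fin 3) F) 2 2))⁻¹ : ℝ≥0) *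
          normAbs F (((blockDiagonalGL F (id : Fin 3 → Fin 3) m : GL (Fin 3) F) : Matrix (Fin 3) (Fin 3) F) 1 1 / ((blockDiagonalGL F (id : Fin 3 → Fin 3) m : GL (Fin 3) F) : Matrix (Fin 3) (Fin 3) F) 0 0)⁻¹ =
          normAbs F (((blockDiagonalGL F (id : Fin 3 → Fin 3) m : GL (Fin 3) F) : Matrix (Fin 3) (Fin 3) F) 0 0) * (normAbs F (((blockDiagonalGL F (id : Fin 3 → Fin 3) m : GL (Fin 3) F) : Matrix (Fin 3) (Fin 3) F) 2 2))⁻¹ := by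
        rw [inv_div, map_div₀]
        field_simp
      rw [hew, hδ1, hδ2, ← key]
      push_cast
      ring
      )
  refine ⟨Λ, hker, hne, fun m x hx => ?_⟩
  rw [hequiv m x hx]
  congr 2
  have hew' : ew * ((rootDeltaChar (standardParabolicGL F (id : Fin 3 → Fin 3))).comp (leviEmbeddingP F (id : Fin 3 → Fin 3)))⁻¹ =
      χ.comp ((leviProjection F (id : Fin 3 → Fin 3)).comp conjB) := by
    ext n
    simp only [ew, MonoidHom.mul_apply, MonoidHom.inv_apply, MonoidHom.coe_comp, Function.comp_apply, mul_inv_cancel_right]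
  rw [hew']
  rfl

/-! ## §3 Cell `s₂ = (1 2)`: `Γ = U_{α₂} ≅ F`, `S = U_{Q′}` (normal in `Q′ ⊇ U`) -/

set_option maxHeartbeats 400000 in
/-- **Cell `s₂` contributes exactly a line to `r_U(Ind_B χδ^{1/2})`, with exponent `χ ∘ Ad(P_{s₂})`** (★ E3γ2 with the cell datum of ★ E3β₁, the Haar measure of ★ E3β₂
transported from `μ_F`; `hinv` by normality of `U_{Q′}` in `U` and right invariance; `hT` by the substitution `y ↦ (d₂/d₁)y` of module `‖d₁/d₂‖ = δ^{1/2}(diag)/δ^{1/2}(P diag P⁻¹)`).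
[cite: BernsteinZelevinsky1977, Thm. 5.2] [cite: Casselman1995, §6.3, Thm. 6.3.5] -/
theorem exists_lineFunctional_cell_swap_one_two (χ : (Π a : Fin 3, GL {i : Fin 3 // (id : Fin 3 → Fin 3) i = a} F) →* ℂˣ) (hχ : IsOpen (χ.ker : Set (Π a : Fin 3, GL {i : Fin 3 // (id : Fin 3 → Fin 3) i = a} F))) :
    let σ' := Representation.twist (((Representation.trivial ℂ (Π a : Fin 3, GL {i : Fin 3 // (id : Fin 3 → Fin 3) i = a} F) ℂ).twist χ).comp (leviProjection F (id : Fin 3 → Fin 3))) (rootDeltaChar (standardParabolicGL F (id : Fin 3 → Fin 3)))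
    let I := smoothIndRep (standardParabolicGL F (id : Fin 3 → Fin 3)) σ'
    let mk := Coinvariants.mk (restrictUnipotentGL F (id : Fin 3 → Fin 3) I)
    let Flt := (vanishingOn (standardParabolicGL F (id : Fin 3 → Fin 3)) σ' (cellLT (K := F) (id : Fin 3 → Fin 3) (Equiv.swap (1 : Fin 3) 2))).map mk
    let Fle := (vanishingOn (standardParabolicGL F (id : Fin 3 → Fin 3)) σ' (cellLE (K := F) (id : Fin 3 → Fin 3) (Equiv.swap (1 : Fin 3) 2))).map mk
    ∃ Λ : (restrictUnipotentGL F (id : Fin 3 → Fin 3) I).Coinvariants →ₗ[ℂ] ℂ,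
      (∀ x ∈ Flt, Λ x = 0 ↔ x ∈ Fle) ∧ (∃ x ∈ Flt, Λ x ≠ 0) ∧
      ∀ (m : (Π a : Fin 3, GL {i : Fin 3 // (id : Fin 3 → Fin 3) i = a} F)), ∀ x ∈ Flt,
        Λ (Representation.normalizedJacquetGL F (id : Fin 3 → Fin 3) I m x) =
          ((χ (leviProjection F (id : Fin 3 → Fin 3) ⟨(permGL (Equiv.swap (1 : Fin 3) 2) : GL (Fin 3) F) * blockDiagonalGL F (id : Fin 3 → Fin 3) m * (permGL (Equiv.swap (1 : Fin 3) 2) : GL (Fin 3) F)⁻¹, permGL_conj_blockDiagonalGL_mem_borel (Equiv.swap (1 : Fin 3) 2) m⟩) : ℂˣ) : ℂ) * Λ x := by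
  intro σ' I mk Flt Fle
  haveI : T2Space F := (isLocalField F).toT2Space
  haveI : LocallyCompactSpace F := (isLocalField F).toLocallyCompactSpace
  haveI : SecondCountableTopology F := secondCountableTopology_localField F
  letI : MeasurableSpace F := borel F
  haveI : BorelSpace F := ⟨rfl⟩
  -- the cell datum (★ E3β₁) and the retraction (★ E3β₂)
  obtain ⟨hΓlow, hS, hSB, hdec⟩ := cellDatum_swap_one_two (F := F)
  have hΓU : (unipotentRadicalGL F (![false, false, true] : Fin 3 → Bool) ⊓ standardLeviGL F (![false, true, true] : Fin 3 → Bool)) ≤ upperUnitriangular (Fin 3) F := (rootSubgroups_le (F := F)).2.2.2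
  have hQU : unipotentRadicalGL F (![false, true, true] : Fin 3 → Bool) ≤ upperUnitriangular (Fin 3) F := (rootSubgroups_le (F := F)).2.1
  have hΓcl : IsClosed (((unipotentRadicalGL F (![false, false, true] : Fin 3 → Bool) ⊓ standardLeviGL F (![false, true, true] : Fin 3 → Bool)) : Subgroup (GL (Fin 3) F)) : Set (GL (Fin 3) F)) := by
    rw [Subgroup.coe_inf]; exact (isClosed_unipotentRadicalGL _).inter (isClosed_standardLeviGL _)
  have hΓlim : IsLimitOfCompactOpen ↥(unipotentRadicalGL F (![false, false, true] : Fin 3 → Bool) ⊓ standardLeviGL F (![false, true, true] : Fin 3 → Bool)) := (isLimitOfCompactOpen_upperUnitriangular F 3).of_le hΓU hΓcl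
  obtain ⟨proj, hproj, hprojS⟩ := exists_proj_swap_one_two (F := F)
  -- coordinates (★ p11) and the transported Haar measure on `Γ` (★ E3β₂)
  obtain ⟨e, he⟩ := exists_coordHomeomorph (R := F)
  obtain ⟨φ, hφ, hφadd⟩ := exists_homeomorph_rootGroup_oneTwo e he
  letI : MeasurableSpace ↥(unipotentRadicalGL F (![false, false, true] : Fin 3 → Bool) ⊓ standardLeviGL F (![false, true, true] : Fin 3 → Bool)) := borel _
  haveI : BorelSpace ↥(unipotentRadicalGL F (![false, false, true] : Fin 3 → Bool) ⊓ standardLeviGL F (![false, true, true] : Fin 3 → Bool)) := ⟨rfl⟩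
  obtain ⟨i1, i2, i3⟩ := measure_map_addHomeomorph φ hφadd (Measure.addHaar : Measure F)
  haveI := i1; haveI := i2; haveI := i3
  have hme : MeasurableEmbedding φ := φ.measurableEmbedding
  -- the torus character `e_w = (χ ∘ levi ∘ Ad P_w ∘ diag) · (δ^{1/2} ∘ diag)`
  let conjB : (Π a : Fin 3, GL {i : Fin 3 // (id : Fin 3 → Fin 3) i = a} F) →* ↥(standardParabolicGL F (id : Fin 3 → Fin 3)) :=
    ((MulAut.conj (permGL (Equiv.swap (1 : Fin 3) 2) : GL (Fin 3) F)).toMonoidHom.comp (blockDiagonalGL F (id : Fin 3 → Fin 3))).codRestrict (standardParabolicGL F (id : Fin 3 → Fin 3))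
      (fun m => permGL_conj_blockDiagonalGL_mem_borel (Equiv.swap (1 : Fin 3) 2) m)
  have hconjB : ∀ m : (Π a : Fin 3, GL {i : Fin 3 // (id : Fin 3 → Fin 3) i = a} F), ((conjB m : ↥(standardParabolicGL F (id : Fin 3 → Fin 3))) : GL (Fin 3) F) = (permGL (Equiv.swap (1 : Fin 3) 2) : GL (Fin 3) F) * blockDiagonalGL F (id : Fin 3 → Fin 3) m * (permGL (Equiv.swap (1 : Fin 3) 2) : GL (Fin 3) F)⁻¹ := fun m => rfl
  let ew : (Π a : Fin 3, GL {i : Fin 3 // (id : Fin 3 → Fin 3) i = a} F) →* ℂˣ := (χ.comp ((leviProjection F (id : Fin 3 → Fin 3)).comp conjB)) *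
    (rootDeltaChar (standardParabolicGL F (id : Fin 3 → Fin 3))).comp (leviEmbeddingP F (id : Fin 3 → Fin 3))
  obtain ⟨Λ, hker, hne, hequiv⟩ := exists_lineFunctional_of_cellDatum σ' (Equiv.swap (1 : Fin 3) 2) (unipotentRadicalGL F (![false, false, true] : Fin 3 → Bool) ⊓ standardLeviGL F (![false, true, true] : Fin 3 → Bool)) (unipotentRadicalGL F (![false, true, true] : Fin 3 → Bool)) (isSmooth_inducingChar χ hχ)
    hΓU hΓcl hΓlim hΓlow hS hSB hdec proj hproj hprojS ((Measure.addHaar : Measure F).map φ)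
    (by
      intro u hu f hf
      obtain ⟨s₀, hs₀, γ₀, hγ₀, rfl⟩ := hdec u hu
      have hfun : (fun γ : ↥(unipotentRadicalGL F (![false, false, true] : Fin 3 → Bool) ⊓ standardLeviGL F (![false, true, true] : Fin 3 → Bool)) => (smoothIndRep (standardParabolicGL F (id : Fin 3 → Fin 3)) σ' (s₀ * γ₀) f).toFun ((permGL (Equiv.swap (1 : Fin 3) 2) : GL (Fin 3) F) * ((γ : ↥(unipotentRadicalGL F (![false, false, true] : Fin 3 → Bool) ⊓ standardLeviGL F (![false, true, true] : Fin 3 → Bool))) : GL (Fin 3) F))) =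
          fun γ => f.toFun ((permGL (Equiv.swap (1 : Fin 3) 2) : GL (Fin 3) F) * (((γ * ⟨γ₀, hγ₀⟩ : ↥(unipotentRadicalGL F (![false, false, true] : Fin 3 → Bool) ⊓ standardLeviGL F (![false, true, true] : Fin 3 → Bool)))) : GL (Fin 3) F)) := by
        funext γ
        have hγU : ((γ : ↥(unipotentRadicalGL F (![false, false, true] : Fin 3 → Bool) ⊓ standardLeviGL F (![false, true, true] : Fin 3 → Bool))) : GL (Fin 3) F) ∈ upperUnitriangular (Fin 3) F := hΓU γ.2
        have hγQ : ((γ : ↥(unipotentRadicalGL F (![false, false, true] : Fin 3 → Bool) ⊓ standardLeviGL F (![false, true, true] : Fin 3 → Bool))) : GL (Fin 3) F) ∈ standardParabolicGL F (![false, true, true] : Fin 3 → Bool) :=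
          (upperUnitriangular_le_parabolic_two_block (F := F)).2 hγU
        have hmemS : ((γ : ↥(unipotentRadicalGL F (![false, false, true] : Fin 3 → Bool) ⊓ standardLeviGL F (![false, true, true] : Fin 3 → Bool))) : GL (Fin 3) F) * s₀ * ((γ : ↥(unipotentRadicalGL F (![false, false, true] : Fin 3 → Bool) ⊓ standardLeviGL F (![false, true, true] : Fin 3 → Bool))) : GL (Fin 3) F)⁻¹ ∈ unipotentRadicalGL F (![false, true, true] : Fin 3 → Bool) := conj_mem_unipotentRadicalGL_of_mem_parabolic _ hγQ hs₀
        have hB' := hSB _ hmemS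
        have hU' : (permGL (Equiv.swap (1 : Fin 3) 2) : GL (Fin 3) F) * (((γ : ↥(unipotentRadicalGL F (![false, false, true] : Fin 3 → Bool) ⊓ standardLeviGL F (![false, true, true] : Fin 3 → Bool))) : GL (Fin 3) F) * s₀ * ((γ : ↥(unipotentRadicalGL F (![false, false, true] : Fin 3 → Bool) ⊓ standardLeviGL F (![false, true, true] : Fin 3 → Bool))) : GL (Fin 3) F)⁻¹) * (permGL (Equiv.swap (1 : Fin 3) 2) : GL (Fin 3) F)⁻¹ ∈ upperUnitriangular (Fin 3) F := permGL_conj_mem_upperUnitriangular _ (hQU hmemS) hB'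
        rw [toFun_smoothIndRep_apply]
        have hprod : (permGL (Equiv.swap (1 : Fin 3) 2) : GL (Fin 3) F) * ((γ : ↥(unipotentRadicalGL F (![false, false, true] : Fin 3 → Bool) ⊓ standardLeviGL F (![false, true, true] : Fin 3 → Bool))) : GL (Fin 3) F) * (s₀ * γ₀) =
            ((permGL (Equiv.swap (1 : Fin 3) 2) : GL (Fin 3) F) * (((γ : ↥(unipotentRadicalGL F (![false, false, true] : Fin 3 → Bool) ⊓ standardLeviGL F (![false, true, true] : Fin 3 → Bool))) : GL (Fin 3) F) * s₀ * ((γ : ↥(unipotentRadicalGL F (![false, false, true] : Fin 3 → Bool) ⊓ standardLeviGL F (![false, true, true] : Fin 3 → Bool))) : GL (Fin 3) F)⁻¹) * (permGL (Equiv.swap (1 : Fin 3) 2) : GL (Fin 3) F)⁻¹) * ((permGL (Equiv.swap (1 : Fin 3) 2) : GL (Fin 3) F) * (((γ : ↥(unipotentRadicalGL F (![false, false, true] : Fin 3 → Bool) ⊓ standardLeviGL F (![false, true, true] : Fin 3 → Bool))) : GL (Fin 3) F) * γ₀)) := by group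
        rw [hprod, show (permGL (Equiv.swap (1 : Fin 3) 2) : GL (Fin 3) F) * (((γ : ↥(unipotentRadicalGL F (![false, false, true] : Fin 3 → Bool) ⊓ standardLeviGL F (![false, true, true] : Fin 3 → Bool))) : GL (Fin 3) F) * s₀ * ((γ : ↥(unipotentRadicalGL F (![false, false, true] : Fin 3 → Bool) ⊓ standardLeviGL F (![false, true, true] : Fin 3 → Bool))) : GL (Fin 3) F)⁻¹) * (permGL (Equiv.swap (1 : Fin 3) 2) : GL (Fin 3) F)⁻¹ =
            ((⟨_, unipotentRadicalGL_le F (id : Fin 3 → Fin 3) hU'⟩ : ↥(standardParabolicGL F (id : Fin 3 → Fin 3))) : GL (Fin 3) F) from rfl, SmoothInd.toFun_subgroup_mul,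
          inducingChar_apply_of_mem_upperUnitriangular χ hU']
        rfl
      rw [hfun]
      exact integral_mul_right_eq_self (fun γ : ↥(unipotentRadicalGL F (![false, false, true] : Fin 3 → Bool) ⊓ standardLeviGL F (![false, true, true] : Fin 3 → Bool)) => f.toFun ((permGL (Equiv.swap (1 : Fin 3) 2) : GL (Fin 3) F) * ((γ : ↥(unipotentRadicalGL F (![false, false, true] : Fin 3 → Bool) ⊓ standardLeviGL F (![false, true, true] : Fin 3 → Bool))) : GL (Fin 3) F))) ⟨γ₀, hγ₀⟩
      ) ew (by
      intro m f hf
      have hd0 := blockDiagonalGL_id_three_apply_ne_zero m 0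
      have hd1 := blockDiagonalGL_id_three_apply_ne_zero m 1
      have hd2 := blockDiagonalGL_id_three_apply_ne_zero m 2
      have hmemB : (permGL (Equiv.swap (1 : Fin 3) 2) : GL (Fin 3) F) * blockDiagonalGL F (id : Fin 3 → Fin 3) m * (permGL (Equiv.swap (1 : Fin 3) 2) : GL (Fin 3) F)⁻¹ ∈ standardParabolicGL F (id : Fin 3 → Fin 3) := permGL_conj_blockDiagonalGL_mem_borel (Equiv.swap (1 : Fin 3) 2) m
      -- the integrand: `f(P γ t) = σ′(P t P⁻¹) · f(P (t⁻¹ γ t))`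
      have hfun : (fun γ : ↥(unipotentRadicalGL F (![false, false, true] : Fin 3 → Bool) ⊓ standardLeviGL F (![false, true, true] : Fin 3 → Bool)) => (smoothIndRep (standardParabolicGL F (id : Fin 3 → Fin 3)) σ' (blockDiagonalGL F (id : Fin 3 → Fin 3) m) f).toFun ((permGL (Equiv.swap (1 : Fin 3) 2) : GL (Fin 3) F) * ((γ : ↥(unipotentRadicalGL F (![false, false, true] : Fin 3 → Bool) ⊓ standardLeviGL F (![false, true, true] : Fin 3 → Bool))) : GL (Fin 3) F))) =
          fun γ => (((rootDeltaChar (standardParabolicGL F (id : Fin 3 → Fin 3)) ⟨_, hmemB⟩ : ℂˣ) : ℂ) * (((χ (leviProjection F (id : Fin 3 → Fin 3) ⟨_, hmemB⟩)) : ℂˣ) : ℂ)) *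
            f.toFun ((permGL (Equiv.swap (1 : Fin 3) 2) : GL (Fin 3) F) * ((blockDiagonalGL F (id : Fin 3 → Fin 3) m)⁻¹ * ((γ : ↥(unipotentRadicalGL F (![false, false, true] : Fin 3 → Bool) ⊓ standardLeviGL F (![false, true, true] : Fin 3 → Bool))) : GL (Fin 3) F) * blockDiagonalGL F (id : Fin 3 → Fin 3) m)) := by
        funext γ
        rw [toFun_smoothIndRep_apply]
        have hprod : (permGL (Equiv.swap (1 : Fin 3) 2) : GL (Fin 3) F) * ((γ : ↥(unipotentRadicalGL F (![false, false, true] : Fin 3 → Bool) ⊓ standardLeviGL F (![false, true, true] : Fin 3 → Bool))) : GL (Fin 3) F) * blockDiagonalGL F (id : Fin 3 → Fin 3) m = ((permGL (Equiv.swap (1 : Fin 3) 2) : GL (Fin 3) F) * blockDiagonalGL F (id : Fin 3 → Fin 3) m * (permGL (Equiv.swap (1 : Fin 3) 2) : GL (Fin 3) F)⁻¹) * ((permGL (Equiv.swap (1 : Fin 3) 2) : GL (Fin 3) F) * ((blockDiagonalGL F (id : Fin 3 → Fin 3) m)⁻¹ * ((γ : ↥(unipotentRadicalGL F (![false, false,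 true] : Fin 3 → Bool) ⊓ standardLeviGL F (![false, true, true] : Fin 3 → Bool))) : GL (Fin 3) F) * blockDiagonalGL F (id : Fin 3 → Fin 3) m)) := by group
        rw [hprod]
        refine (SmoothInd.toFun_subgroup_mul f ⟨_, hmemB⟩ _).trans ?_
        rw [inducingChar_apply]
        exact (mul_assoc _ _ _).symm
      rw [hfun, integral_const_mul]
      -- the substitution `γ ↦ t⁻¹ γ t` on `Γ ≅ F`: `x ↦ α x`, `α = d₁/d₀`, module `‖α⁻¹‖`
      have hα : (((blockDiagonalGL F (id : Fin 3 → Fin 3) m : GL (Fin 3) F) : Matrix (Fin 3) (Fin 3) F) 2 2 / ((blockDiagonalGL F (id : Fin 3 → Fin 3) m : GL (Fin 3) F) : Matrix (Fin 3) (Fin 3) F) 1 1) ≠ 0 := div_ne_zero hd2 hd1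
      have hconj : ∀ x : F, (blockDiagonalGL F (id : Fin 3 → Fin 3) m)⁻¹ * ((φ x : ↥(unipotentRadicalGL F (![false, false, true] : Fin 3 → Bool) ⊓ standardLeviGL F (![false, true, true] : Fin 3 → Bool))) : GL (Fin 3) F) * blockDiagonalGL F (id : Fin 3 → Fin 3) m =
          ((φ ((((blockDiagonalGL F (id : Fin 3 → Fin 3) m : GL (Fin 3) F) : Matrix (Fin 3) (Fin 3) F) 2 2 / ((blockDiagonalGL F (id : Fin 3 → Fin 3) m : GL (Fin 3) F) : Matrix (Fin 3) (Fin 3) F) 1 1) * x) : ↥(unipotentRadicalGL F (![false, false, true] : Fin 3 → Bool) ⊓ standardLeviGL F (![false, true, true] : Fin 3 → Bool))) : GL (Fin 3) F) := by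
        intro x
        rw [hφ, hφ, blockDiagonalGL_inv_mul_coord_mul e he m ((0, x), 0)]
        congr 2
        ext <;> simp; ring
      have hsub : ∫ γ, f.toFun ((permGL (Equiv.swap (1 : Fin 3) 2) : GL (Fin 3) F) * ((blockDiagonalGL F (id : Fin 3 → Fin 3) m)⁻¹ * ((γ : ↥(unipotentRadicalGL F (![false, false, true] : Fin 3 → Bool) ⊓ standardLeviGL F (![false, true, true] : Fin 3 → Bool))) : GL (Fin 3) F) * blockDiagonalGL F (id : Fin 3 → Fin 3) m)) ∂((Measure.addHaar : Measure F).map φ) =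
          ((normAbs F (((blockDiagonalGL F (id : Fin 3 → Fin 3) m : GL (Fin 3) F) : Matrix (Fin 3) (Fin 3) F) 2 2 / ((blockDiagonalGL F (id : Fin 3 → Fin 3) m : GL (Fin 3) F) : Matrix (Fin 3) (Fin 3) F) 1 1)⁻¹ : ℝ≥0) : ℝ) *
            ∫ γ, f.toFun ((permGL (Equiv.swap (1 : Fin 3) 2) : GL (Fin 3) F) * ((γ : ↥(unipotentRadicalGL F (![false, false, true] : Fin 3 → Bool) ⊓ standardLeviGL F (![false, true, true] : Fin 3 → Bool))) : GL (Fin 3) F)) ∂((Measure.addHaar : Measure F).map φ) := by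
        rw [hme.integral_map, hme.integral_map]
        simp_rw [hconj]
        have hmap := map_mul_left_addHaar (Measure.addHaar : Measure F) hα
        have heq := integral_map_equiv ((Homeomorph.mulLeft₀ _ hα).toMeasurableEquiv)
          (fun x : F => f.toFun ((permGL (Equiv.swap (1 : Fin 3) 2) : GL (Fin 3) F) * ((φ x : ↥(unipotentRadicalGL F (![false, false, true] : Fin 3 → Bool) ⊓ standardLeviGL F (![false, true, true] : Fin 3 → Bool))) : GL (Fin 3) F))) (μ := (Measure.addHaar : Measure F))
        rw [Homeomorph.toMeasurableEquiv_coe] at heq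
        change ∫ y, f.toFun ((permGL (Equiv.swap (1 : Fin 3) 2) : GL (Fin 3) F) * ((φ y : ↥(unipotentRadicalGL F (![false, false, true] : Fin 3 → Bool) ⊓ standardLeviGL F (![false, true, true] : Fin 3 → Bool))) : GL (Fin 3) F)) ∂((Measure.addHaar : Measure F).map (fun x => ((blockDiagonalGL F (id : Fin 3 → Fin 3) m : GL (Fin 3) F) : Matrix (Fin 3) (Fin 3) F) 2 2 / ((blockDiagonalGL F (id : Fin 3 → Fin 3) m : GL (Fin 3) F) : Matrix (Fin 3) (Fin 3) F) 1 1 * x)) =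
          ∫ x, f.toFun ((permGL (Equiv.swap (1 : Fin 3) 2) : GL (Fin 3) F) * ((φ (((blockDiagonalGL F (id : Fin 3 → Fin 3) m : GL (Fin 3) F) : Matrix (Fin 3) (Fin 3) F) 2 2 / ((blockDiagonalGL F (id : Fin 3 → Fin 3) m : GL (Fin 3) F) : Matrix (Fin 3) (Fin 3) F) 1 1 * x) : ↥(unipotentRadicalGL F (![false, false, true] : Fin 3 → Bool) ⊓ standardLeviGL F (![false, true, true] : Fin 3 → Bool))) : GL (Fin 3) F)) ∂(Measure.addHaar : Measure F) at heq
        rw [← heq, hmap, integral_smul_measure, ENNReal.coe_toReal, Complex.real_smul]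
      rw [hsub]
      -- the constant: `δ^{1/2}(P t P⁻¹) χ(…) ‖α⁻¹‖ = χ(…) δ^{1/2}(t) = e_w(m)`
      have hw0 : Equiv.swap (1 : Fin 3) 2 0 = 0 := by decide
      have hw2 : Equiv.swap (1 : Fin 3) 2 2 = 1 := by decide
      have hew : ((ew m : ℂˣ) : ℂ) = (((χ (leviProjection F (id : Fin 3 → Fin 3) ⟨_, hmemB⟩)) : ℂˣ) : ℂ) *
          ((rootDeltaChar (standardParabolicGL F (id : Fin 3 → Fin 3)) (leviEmbeddingP F (id : Fin 3 → Fin 3) m) : ℂˣ) : ℂ) := by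
        simp only [ew, MonoidHom.mul_apply, MonoidHom.coe_comp, Function.comp_apply, Units.val_mul]
        rfl
      have hδ1 : ((rootDeltaChar (standardParabolicGL F (id : Fin 3 → Fin 3)) ⟨_, hmemB⟩ : ℂˣ) : ℂ) =
          (((normAbs F (((blockDiagonalGL F (id : Fin 3 → Fin 3) m : GL (Fin 3) F) : Matrix (Fin 3) (Fin 3) F) 0 0) * (normAbs F (((blockDiagonalGL F (id : Fin 3 → Fin 3) m : GL (Fin 3) F) : Matrix (Fin 3) (Fin 3) F) 1 1))⁻¹ : ℝ≥0) : ℝ) : ℂ) := by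
        rw [K2E3GL3BorelModulus.rootDeltaChar_borel_three]
        simp only [permGL_conj_apply, hw0, hw2]
      have hδ2 : ((rootDeltaChar (standardParabolicGL F (id : Fin 3 → Fin 3)) (leviEmbeddingP F (id : Fin 3 → Fin 3) m) : ℂˣ) : ℂ) =
          (((normAbs F (((blockDiagonalGL F (id : Fin 3 → Fin 3) m : GL (Fin 3) F) : Matrix (Fin 3) (Fin 3) F) 0 0) * (normAbs F (((blockDiagonalGL F (id : Fin 3 → Fin 3) m : GL (Fin 3) F) : Matrix (Fin 3) (Fin 3) F) 2 2))⁻¹ : ℝ≥0) : ℝ) : ℂ) := by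
        rw [K2E3GL3BorelModulus.rootDeltaChar_borel_three, coe_leviEmbeddingP]
      have hn1 : normAbs F (((blockDiagonalGL F (id : Fin 3 → Fin 3) m : GL (Fin 3) F) : Matrix (Fin 3) (Fin 3) F) 1 1) ≠ 0 := (map_ne_zero _).2 hd1
      have hn2 : normAbs F (((blockDiagonalGL F (id : Fin 3 → Fin 3) m : GL (Fin 3) F) : Matrix (Fin 3) (Fin 3) F) 2 2) ≠ 0 := (map_ne_zero _).2 hd2
      have hn0 : normAbs F (((blockDiagonalGL F (id : Fin 3 → Fin 3) m : GL (Fin 3) F) : Matrix (Fin 3) (Fin 3) F) 0 0) ≠ 0 := (map_ne_zero _).2 hd0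
      have key : (normAbs F (((blockDiagonalGL F (id : Fin 3 → Fin 3) m : GL (Fin 3) F) : Matrix (Fin 3) (Fin 3) F) 0 0) * (normAbs F (((blockDiagonalGL F (id : Fin 3 → Fin 3) m : GL (Fin 3) F) : Matrix (Fin 3) (Fin 3) F) 1 1))⁻¹ : ℝ≥0) *
          normAbs F (((blockDiagonalGL F (id : Fin 3 → Fin 3) m : GL (Fin 3) F) : Matrix (Fin 3) (Fin 3) F) 2 2 / ((blockDiagonalGL F (id : Fin 3 → Fin 3) m : GL (Fin 3) F) : Matrix (Fin 3) (Fin 3) F) 1 1)⁻¹ =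
          normAbs F (((blockDiagonalGL F (id : Fin 3 → Fin 3) m : GL (Fin 3) F) : Matrix (Fin 3) (Fin 3) F) 0 0) * (normAbs F (((blockDiagonalGL F (id : Fin 3 → Fin 3) m : GL (Fin 3) F) : Matrix (Fin 3) (Fin 3) F) 2 2))⁻¹ := by
        rw [inv_div, map_div₀]
        field_simp
      rw [hew, hδ1, hδ2, ← key]
      push_cast
      ring
      )
  refine ⟨Λ, hker, hne, fun m x hx => ?_⟩
  rw [hequiv m x hx]
  congr 2
  have hew' : ew * ((rootDeltaChar (standardParabolicGL F (id : Fin 3 → Fin 3))).comp (leviEmbeddingP F (id : Fin 3 → Fin 3)))⁻¹ =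
      χ.comp ((leviProjection F (id : Fin 3 → Fin 3)).comp conjB) := by
    ext n
    simp only [ew, MonoidHom.mul_apply, MonoidHom.inv_apply, MonoidHom.coe_comp, Function.comp_apply, mul_inv_cancel_right]
  rw [hew']
  rfl

end Summit.HodgeConjecture.HodgeConjecture.Cruxes.H413.K2E3GL3BruhatCellFunctionals
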